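import Summits.Ventures.GridStability.Models.NE39SPSlab
import Summits.Ventures.GridStability.Lyapunov.NE39SPSlabCData

/-!
# GridStability/Bench/NE39SPSlabCDefs — «G2-Q NE39SP SLAB»: the relative system's matrices and lit-6's slab blocks
# over `ℚ` (structural definitions; the identity with `AqS` is decided in `NE39SPSlabCId1…`)

Cell `gridfusion` (LADDER-GRIDFUSION), SP–Lur'e lane, row «G2-Q NE39SP SLAB» (n = 58 structure-preserving quadratic-tier
kernel row; lead R-G2-WAVE1 (b)(iii), R-SP9-ROW AMENDMENT); seat gridfusion-model-2 (g6). OBJECT `NE39SP.relLurie D`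
(p494720), D = `1/10` uniform SYNTHETIC (R-SPCERT token); CERTIFICATE = sos-4's STRUCTURED-P («nbr», clique route) slab certificate cert/sos-4/j272825/lchord-R5-NE39SP-D1o10-nbr-csJ.json 3f9f274c5104abf6
(lead RULING (R-a) AMENDED 08:21:56Z, row candidate «G2.b-NE39SP-SLAB-CLQ» #53; slab `u = 1/4`, `γ_lo = 97/200`, `a = 5/8`, `b = 1`, `η = 1/1000`, `ε_P = 479/2²⁴`), data `Lyapunov/NE39SPSlabCData` (model-2's exact copy of sos-4's structured-P hand-over 5a053876f8a67723, re-checked by kit j273502: −slabMatrix and P − ε1 equal entry by entry; json models/NE39SP-slabC-instance.json 0350c97bce3d88be); PSD side = sos-4's clique Gram files + lit-6's CliqueBlockEmbedding glue. LABEL: pipeline object on a structure-preserving NE39 VARIANT with DECLARED SYNTHETIC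
DAMPING — not a sentence about the printed New England system (MODEL-VALIDITY v0.33 R-SPCERT).
-/

noncomputable section

open Set Filter Topology Real Matrix
open Literature.MathematicalPhysics.PowerSystems
open Literature.MathematicalPhysics.PowerSystems.LyapunovFunctionFamily
open Literature.Computation.Certificates
open Summit.Ventures.GridStability.Models
open Summit.Ventures.GridStability.Models.StructurePreserving
open Summit.Ventures.GridStability.Models.NE39SP
open Summit.Ventures.GridStability.Lyapunov.NE39SPSlabC

namespace Summit.Ventures.GridStability.Bench.NE39SPSlabC

/-- The DECLARED damping / load-frequency vector: `1/10` at every node (SYNTHETIC; R-SPCERT token). -/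
def D : Fin 49 → ℝ := fun _ => ((1 / 10 : ℚ) : ℝ)

/-- `D > 0`. -/
theorem hD : ∀ v, 0 < D v := fun _ => by unfold D; norm_num

/-- state index flattening `Fin 48 ⊕ Fin 10 ≃ Fin 58`. -/
def e1 : Fin 48 ⊕ Fin 10 ≃ Fin 58 := finSumFinEquiv

/-- certificate-matrix index flattening `(Fin 48 ⊕ Fin 10) ⊕ Fin 56 ≃ Fin 114`. -/
def e2 : (Fin 48 ⊕ Fin 10) ⊕ Fin 56 ≃ Fin 114 :=
  (Equiv.sumCongr finSumFinEquiv (Equiv.refl (Fin 56))).trans finSumFinEquiv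

/-- incidence numbers over `ℚ`. -/
def edgeIncQ (e : Fin 56) (v : Fin 49) : ℚ :=
  (if srcV e = v then 1 else 0) - (if tgtV e = v then 1 else 0)

/-- `A` over `ℚ` (shape of `Params.relA`; `D = 1/10`). -/
def AQ : Matrix (Fin 48 ⊕ Fin 10) (Fin 48 ⊕ Fin 10) ℚ
  | Sum.inl _, Sum.inl _ => 0
  | Sum.inl i, Sum.inr j => if ref.succAbove i = gnode j then 1 else 0
  | Sum.inr _, Sum.inl _ => 0
  | Sum.inr j, Sum.inr j' => if j = j' then -((1 / 10 : ℚ) / MQ (gnode j)) else 0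

/-- `B` over `ℚ` (shape of `Params.relB`; `D = 1/10`, column LF weights). -/
def BQ : Matrix (Fin 48 ⊕ Fin 10) (Fin 56) ℚ
  | Sum.inl i, e => ((if ref.succAbove i ∈ genS then 0
      else edgeIncQ e (ref.succAbove i) / (1 / 10 : ℚ)) - edgeIncQ e ref / (1 / 10 : ℚ)) * wtLFQ e
  | Sum.inr j, e => edgeIncQ e (gnode j) / MQ (gnode j) * wtLFQ e

/-- `C` over `ℚ` (shape of `Params.relC`). -/
def CQ : Matrix (Fin 56) (Fin 48 ⊕ Fin 10) ℚ
  | e, Sum.inl i => edgeIncQ e (ref.succAbove i)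
  | _, Sum.inr _ => 0

/-- `P` over `ℚ`, reindexed to the state type. -/
def PQB : Matrix (Fin 48 ⊕ Fin 10) (Fin 48 ⊕ Fin 10) ℚ := PSq.submatrix e1 e1

/-- `τ_e·a·b` (`a = 5/8`, `b = 1`). -/
def tabQ : Fin 56 → ℚ := fun e => tauSQ e * (aSQ * 1)

/-- `τ_e·(a + b)/2`. -/
def tab2Q : Fin 56 → ℚ := fun e => tauSQ e * (aSQ + 1) / 2

/-- state block over `ℚ`. -/
def L11Q : Matrix (Fin 48 ⊕ Fin 10) (Fin 48 ⊕ Fin 10) ℚ :=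
  AQᵀ * PQB + PQB * AQ + etaSQ • (1 : Matrix (Fin 48 ⊕ Fin 10) (Fin 48 ⊕ Fin 10) ℚ)
    - CQᵀ * Matrix.diagonal tabQ * CQ

/-- cross block over `ℚ`. -/
def L12Q : Matrix (Fin 48 ⊕ Fin 10) (Fin 56) ℚ :=
  -(PQB * BQ) + (CQ * AQ)ᵀ * Matrix.diagonal lamSQ + CQᵀ * Matrix.diagonal tab2Q

/-- channel block over `ℚ`. -/
def L22Q : Matrix (Fin 56) (Fin 56) ℚ :=
  -(Matrix.diagonal lamSQ * (CQ * BQ)) - (Matrix.diagonal lamSQ * (CQ * BQ))ᵀ - Matrix.diagonal tauSQ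

/-- `−𝓛` over `ℚ` on the sum index type. -/
def negLQ : Matrix ((Fin 48 ⊕ Fin 10) ⊕ Fin 56) ((Fin 48 ⊕ Fin 10) ⊕ Fin 56) ℚ :=
  -(Matrix.fromBlocks L11Q L12Q L12Qᵀ L22Q)

/-- the flattened identity to be decided row block by row block. -/
def IdRow (p : Fin 114) : Prop := ∀ q : Fin 114, negLQ (e2.symm p) (e2.symm q) = AqS p q

/-- `IdRow p` is decidable (a finite conjunction of rational equalities). -/
instance (p : Fin 114) : Decidable (IdRow p) := by unfold IdRow; infer_instance

/-- incidence numbers are casts. -/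
theorem edgeInc_eq (e : Fin 56) (v : Fin 49) :
    edgeInc srcV tgtV e v = ((edgeIncQ e v : ℚ) : ℝ) := by
  unfold edgeInc edgeIncQ
  split_ifs <;> norm_num

/-- `A = AQ ↦ ℝ`. -/
theorem A_eq : (NE39SP.relLurie D).A = AQ.map (Rat.cast : ℚ → ℝ) := by
  ext a b
  rcases a with i | j <;> rcases b with i' | j'
  · simp [NE39SP.relLurie, Params.relLurie, Params.relA, AQ]
  · by_cases h : ref.succAbove i = gnode j'
    · simp [NE39SP.relLurie, Params.relLurie, Params.relA, AQ, h]
    · simp [NE39SP.relLurie, Params.relLurie, Params.relA, AQ, h]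
  · simp [NE39SP.relLurie, Params.relLurie, Params.relA, AQ]
  · by_cases h : j = j'
    · subst h
      simp [NE39SP.relLurie, Params.relLurie, Params.relA, AQ, NE39SP.params, D]
    · simp [NE39SP.relLurie, Params.relLurie, Params.relA, AQ, h]

/-- `B = BQ ↦ ℝ`. -/
theorem B_eq : (NE39SP.relLurie D).B = BQ.map (Rat.cast : ℚ → ℝ) := by
  ext a e
  rcases a with i | j
  · by_cases h : ref.succAbove i ∈ genS
    · simp [NE39SP.relLurie, Params.relLurie, Params.relB, BQ, NE39SP.params, h, D, wt, edgeInc_eq]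
    · simp [NE39SP.relLurie, Params.relLurie, Params.relB, BQ, NE39SP.params, h, D, wt, edgeInc_eq]
  · simp [NE39SP.relLurie, Params.relLurie, Params.relB, BQ, NE39SP.params, wt, edgeInc_eq]

/-- `C = CQ ↦ ℝ`. -/
theorem C_eq : (NE39SP.relLurie D).C = CQ.map (Rat.cast : ℚ → ℝ) := by
  ext e b
  rcases b with i | j
  · simp [NE39SP.relLurie, Params.relLurie, Params.relC, CQ, edgeInc_eq]
  · simp [NE39SP.relLurie, Params.relLurie, Params.relC, CQ]

end Summit.Ventures.GridStability.Bench.NE39SPSlabC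

end
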